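import Summits.Ventures.YMGap.RobustBall.ZdPairwiseColumn
import Summits.Ventures.YMGap.SlabAreaLawDimensions
import Literature.MathematicalPhysics.QuantumFieldTheory.Balaban1983to89.StrongCouplingKernelWindow
import HarnessLib

/-!
# Robust ball (Y2) — `ℓ∞`-separation clustering on `ℤ^d` at the axis rate, SHARP FORM: margin only at the target
# (`|cov_μ(f,g)| ≤ (4N/(θ(1−s₀))) (Σδ_g)(Σδ_f) θ^{2n}` with the slope condition `≤ 1` and `s₀` the TARGET ROW only)

HONEST FRAMING: venture file of the cell `pub-ymgap` (QuantumFields programme), track ROBUST-BALL, seat rb-p2 (g11).  Strong-coupling LATTICE bookkeeping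
(Dobrushin comparison in Föllmer's pairwise form) for specifications of `SU(N)` link variables on `ℤ^d` and the Wilson specification; the one-link modulus
`OneLinkKRModulus N b K` is a hypothesis by name (cells: the tree's quarter modulus for `SU(2)`); the rates are floors on the decay of truncated correlations, not
computations of the mass gap; nothing continuum / spectral / Clay.

WHAT IS NEW over `ZdPairwiseColumn.abs_cov_le_linfty_of_split` (margin `s < 1` in EVERY column inequality, constant `1/(1−s)`).  In the Lyapunov form of the
pairwise estimate the margin is needed only AT THE TARGET `x = y`, where the two-sided profile has slack: the target row of `θ^{|H_i · − H_i y|}` along the axis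
of `y` is `A·2(d−1)(2θ+1) + Λ`, not `A·P(θ) + Λθ⁻¹^{2R+1}`.  RESULTS:
* (`ZdPairwiseColumn.abs_covariance_le_pairwise_of_target` — the generic Lyapunov form with margin at the target only, constant `R²/(1−s₀)`);
* `column_target_le_of_split` — the target row of the two-sided profile along the link's own axis: `≤ A·2(d−1)(2θ+1) + Λ`;
* `abs_cov_le_linfty_of_split_sharp` — generic `ℤ^d` split door: rows `A·6(d−1) + Λ < 1`, slope `A·P(θ) + Λθ⁻¹^{2R+1} ≤ 1`, target `A·2(d−1)(2θ+1) + Λ ≤ s₀ < 1` ⇒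
  `|cov_μ(f,g)| ≤ (4N/(θ(1−s₀)))(Σδ_g)(Σδ_f) θ^{2n}` for ALL local `f, g` at `ℓ∞`-distance `≥ n`;
* `ym_abs_cov_le_linfty_sharp` — the Wilson centre (`A = K|β|`, `Λ = 0`; the slope condition is exactly the pair of conditions of `ZdAxisClustering.ym_abs_cov_le_axis`);
* cells, `SU(2)`: `d = 4`, `β_W = 1/8`: `θ = 2/7`, `s₀ = 3/10`, constant `40`, rate `log(49/4) = 2.505` per lattice unit (`su2_abs_cov_le_linfty_sharp_oneEighth`; margin form:
  `2000/3`, rate `2.41`); ★★ LAWS `θ = √β_W`, `s₀ = 1/2`: `d = 4` on `0 < β_W ≤ 1/6`: `|cov| ≤ (16/√β_W)(Σδ_g)(Σδ_f) β_W^n` (`su2_abs_cov_le_linfty_sharp_law_dim4`);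
  rate `log(1/β_W)` per lattice unit, every DLR state, arbitrary supports (the `d = 3` law on `(0, 1/4]` with the same constant is `ZdPairwiseCells.su2_abs_cov_le_linfty_sharp_law_dim3`);
  ★★ every `N ≥ 2`, `d = 4`, closed form `θ = 2√κ`, `κ = b/(1/2−6b)`, `0 < b ≤ 1/64`, `s₀ = 1/2`: `|cov| ≤ (4N/√κ)(Σδ_g)(Σδ_f)(4κ)^n` (`suN_abs_cov_le_linfty_sharp_dim4`).

References: H. Föllmer, LNM 1362 (1988), Ch. I, Thm. (2.13), Remark (2.17); H. Künsch, CMP 84 (1982) 207; the tree: `DobrushinPairwise`, `ZdPairwiseColumn`, `ZdAxisProfile`.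
-/

noncomputable section

open MeasureTheory ProbabilityTheory Filter Topology Function Finset Real
open scoped NNReal
open Literature.Probability.LatticeModels
open Literature.Probability.LatticeModels.DobrushinMetric
open Literature.MathematicalPhysics.QuantumLattice
open Literature.MathematicalPhysics.QuantumFieldTheory hiding ZdEdge
open Literature.MathematicalPhysics.QuantumFieldTheory.Balaban1983to89.StrongCouplingDobrushinWindow (OneLinkKRModulus)
open Summit.Ventures.YMGap.RobustBall.DobrushinPairwise

namespace Summit.Ventures.YMGap.RobustBall.ZdAxis

variable {d N : ℕ}

/-! ### The target row of the two-sided profile along the link's own axis -/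

/-- **THE TARGET ROW.**  For a split matrix `C ≤ A·linkInfluence + L` (`A, L ≥ 0`, rows of `L` `≤ Λ`) and `0 < θ ≤ 1`, at the centre link `y` itself and along
ITS OWN axis `i = dir y`: `Σ_{z ∈ nbr y} C(y,z) θ^{|H_i z − H_i y|} ≤ A·2(d−1)(2θ+1) + Λ` (staple offsets `{+1, 0, −1}` per plaquette; `θ^{|k|} ≤ 1` on the load part).
[folklore] -/
theorem column_target_le_of_split (hd : 2 ≤ d) {nbr : ZdEdge d → Finset (ZdEdge d)} {C : ZdEdge d → ZdEdge d → ℝ} {A Λ : ℝ}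
    (hA : 0 ≤ A) {L : ZdEdge d → ZdEdge d → ℝ} (hL0 : ∀ e y, 0 ≤ L e y)
    (hsplit : ∀ e, ∀ y ∈ nbr e, C e y ≤ A * linkInfluence e y + L e y) (hLrow : ∀ e, ∑ y ∈ nbr e, L e y ≤ Λ)
    {θ : ℝ} (hθ0 : 0 < θ) (hθ1 : θ ≤ 1) (y : ZdEdge d) :
    ∑ z ∈ nbr y, C y z * θ ^ ((2 * z.1 y.2 + (if z.2 = y.2 then 1 else 0)) - (2 * y.1 y.2 + (if y.2 = y.2 then 1 else 0))).natAbs ≤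
      A * (2 * ((d : ℝ) - 1) * (2 * θ + 1)) + Λ := by
  classical
  set i : Fin d := y.2 with hi
  set u : ZdEdge d → ℝ := fun z => θ ^ ((2 * z.1 i + (if z.2 = i then 1 else 0)) - (2 * y.1 i + (if y.2 = i then 1 else 0))).natAbs
    with hu
  change ∑ z ∈ nbr y, C y z * u z ≤ _
  have hu0 : ∀ z, 0 ≤ u z := fun z => pow_nonneg hθ0.le _
  have hu1 : ∀ z, u z ≤ 1 := fun z => pow_le_one₀ hθ0.le hθ1
  have huy : u y = 1 := by simp [hu]
  set c : ℤ → ℝ := fun D => θ ^ D.natAbs with hc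
  have hc0 : ∀ D, 0 ≤ c D := fun D => pow_nonneg hθ0.le _
  have hratio : ∀ w : ZdEdge d, u w ≤ c (2 * (w.1 i - y.1 i) + (if w.2 = i then 1 else 0) - (if y.2 = i then 1 else 0)) * u y := by
    intro w
    rw [huy, mul_one]
    have e : (2 * w.1 i + (if w.2 = i then 1 else 0)) - (2 * y.1 i + (if y.2 = i then 1 else 0)) =
        2 * (w.1 i - y.1 i) + (if w.2 = i then 1 else 0) - (if y.2 = i then 1 else 0) := by ring
    simp only [hu, hc]
    rw [e]
  have keyW := sum_linkInfluence_mul_le_axis hd c hc0 y i hu0 hratio (nbr y)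
  have hyi : y.2 = i := rfl
  rw [if_pos hyi, huy, mul_one] at keyW
  have hc1 : c 1 = θ := by simp [hc]
  have hc0' : c 0 = 1 := by simp [hc]
  have hcm1 : c (-1) = θ := by simp [hc]
  rw [hc1, hc0', hcm1] at keyW
  have hd1 : ((d - 1 : ℕ) : ℝ) = (d : ℝ) - 1 := by rw [Nat.cast_sub (by omega)]; simp
  rw [hd1] at keyW
  have keyL : ∑ z ∈ nbr y, L y z * u z ≤ Λ := by
    calc ∑ z ∈ nbr y, L y z * u z ≤ ∑ z ∈ nbr y, L y z * 1 :=
          Finset.sum_le_sum fun z _ => mul_le_mul_of_nonneg_left (hu1 z) (hL0 y z)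
      _ ≤ Λ := by simpa using hLrow y
  calc ∑ z ∈ nbr y, C y z * u z ≤ ∑ z ∈ nbr y, (A * linkInfluence y z + L y z) * u z :=
        Finset.sum_le_sum fun z hz => mul_le_mul_of_nonneg_right (hsplit y z hz) (hu0 z)
    _ = A * ∑ z ∈ nbr y, (linkInfluence y z : ℝ) * u z + ∑ z ∈ nbr y, L y z * u z := by
        rw [Finset.mul_sum, ← Finset.sum_add_distrib]; exact Finset.sum_congr rfl fun z _ => by ring
    _ ≤ A * (2 * ((d : ℝ) - 1) * (θ + 1 + θ)) + Λ := add_le_add (mul_le_mul_of_nonneg_left keyW hA) keyL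
    _ = A * (2 * ((d : ℝ) - 1) * (2 * θ + 1)) + Λ := by ring

/-! ### The sharp generic bound -/

/-- **`ℓ∞`-SEPARATION CLUSTERING FROM A SPLIT DOBRUSHIN MATRIX, SHARP FORM.**  `γ` a specification of `SU(N)` link variables on `ℤ^d` (`d ≥ 2`) with a KR
contraction `C ≤ A·linkInfluence + L` over `nbr` (`A, L ≥ 0`, rows of `L` `≤ Λ`, `ℓ∞`-range `≤ R`), ROWS `A·6(d−1) + Λ < 1`; `0 < θ ≤ 1` with the SLOPE condition
`A·max(2(d−1)(θ+θ⁻¹+1), θ⁻²+2θ⁻¹+2θ+θ²+6(d−2)) + Λθ⁻¹^{2R+1} ≤ 1` and the TARGET condition `A·2(d−1)(2θ+1) + Λ ≤ s₀ < 1`.  Then every Gibbs measure and all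
bounded measurable local `f, g` with supports at `ℓ∞`-distance `≥ n` satisfy `|cov_μ(f,g)| ≤ (4N/(θ(1−s₀))) (Σδ_g)(Σδ_f) θ^{2n}`. [cite: Follmer1988, Ch. I Theorem (2.13)] -/
theorem abs_cov_le_linfty_of_split_sharp (hd : 2 ≤ d) {γ : Specification (ZdEdge d) (Matrix.specialUnitaryGroup (Fin N) ℂ)}
    (hγ : IsSpecification γ) {nbr : ZdEdge d → Finset (ZdEdge d)} {C : ZdEdge d → ZdEdge d → ℝ}
    (hKR : IsKRContraction γ suFrobDist nbr C) {A Λ : ℝ} (hA : 0 ≤ A) {L : ZdEdge d → ZdEdge d → ℝ}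
    (hL0 : ∀ e y, 0 ≤ L e y) (hsplit : ∀ e, ∀ y ∈ nbr e, C e y ≤ A * linkInfluence e y + L e y)
    (hLrow : ∀ e, ∑ y ∈ nbr e, L e y ≤ Λ) {R : ℕ} (hnbr : ∀ e, ∀ y ∈ nbr e, ‖e.1 - y.1‖ ≤ (R : ℝ))
    (hρ : A * (6 * ((d : ℝ) - 1)) + Λ < 1) {θ s₀ : ℝ} (hθ0 : 0 < θ) (hθ1 : θ ≤ 1)
    (hsup : A * max (2 * ((d : ℝ) - 1) * (θ + θ⁻¹ + 1)) (θ⁻¹ ^ 2 + 2 * θ⁻¹ + 2 * θ + θ ^ 2 + 6 * ((d : ℝ) - 2)) +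
      Λ * θ⁻¹ ^ (2 * R + 1) ≤ 1)
    (hs0 : A * (2 * ((d : ℝ) - 1) * (2 * θ + 1)) + Λ ≤ s₀) (hs1 : s₀ < 1)
    {μ : Measure (LGConfig d (Matrix.specialUnitaryGroup (Fin N) ℂ))} (hμ : IsGibbsMeasure γ μ)
    {f g : LGConfig d (Matrix.specialUnitaryGroup (Fin N) ℂ) → ℝ} (hfm : Measurable f) {Δf : Finset (ZdEdge d)}
    (hfdep : DependsOn f (↑Δf : Set (ZdEdge d))) {Mf : ℝ} (hMf : ∀ σ, |f σ| ≤ Mf) {δf : ZdEdge d → ℝ}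
    (hδf : IsLipBound suFrobDist f δf) (hgm : Measurable g) {Δg : Finset (ZdEdge d)}
    (hgdep : DependsOn g (↑Δg : Set (ZdEdge d))) {Mg : ℝ} (hMg : ∀ σ, |g σ| ≤ Mg) {δg : ZdEdge d → ℝ}
    (hδg : IsLipBound suFrobDist g δg) (n : ℕ) (hdist : ∀ x ∈ Δf, ∀ y ∈ Δg, (n : ℝ) ≤ ‖x.1 - y.1‖) :
    |cov[f, g; μ]| ≤ 4 * N / (θ * (1 - s₀)) * (∑ y ∈ Δg, δg y) * (∑ x ∈ Δf, δf x) * θ ^ (2 * n) := by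
  classical
  have hd0 : 0 < d := by omega
  have hd1 : 1 ≤ d := by omega
  -- the rows
  have hΛ0 : 0 ≤ Λ := by
    let e₀ : ZdEdge d := (0, ⟨0, hd0⟩)
    exact (Finset.sum_nonneg fun y _ => hL0 e₀ y).trans (hLrow e₀)
  have hrow : ∀ x, ∑ z ∈ nbr x, C x z ≤ A * (6 * ((d : ℝ) - 1)) + Λ := by
    intro x
    have hn : ∑ z ∈ nbr x, (linkInfluence x z : ℝ) ≤ 6 * ((d : ℝ) - 1) := by
      have h := sum_linkInfluence_le_of_subset x (nbr x)
      calc ∑ z ∈ nbr x, (linkInfluence x z : ℝ) = ((∑ z ∈ nbr x, linkInfluence x z : ℕ) : ℝ) := by push_cast; rfl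
        _ ≤ ((6 * (d - 1) : ℕ) : ℝ) := by exact_mod_cast h
        _ = 6 * ((d : ℝ) - 1) := by push_cast [Nat.cast_sub hd1]; ring
    calc ∑ z ∈ nbr x, C x z ≤ ∑ z ∈ nbr x, (A * linkInfluence x z + L x z) := Finset.sum_le_sum fun z hz => hsplit x z hz
      _ = A * ∑ z ∈ nbr x, (linkInfluence x z : ℝ) + ∑ z ∈ nbr x, L x z := by rw [Finset.mul_sum, ← Finset.sum_add_distrib]
      _ ≤ A * (6 * ((d : ℝ) - 1)) + Λ := add_le_add (mul_le_mul_of_nonneg_left hn hA) (hLrow x)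
  have hρ0 : 0 ≤ A * (6 * ((d : ℝ) - 1)) + Λ :=
    (Finset.sum_nonneg fun z _ => hKR.nonneg _ z).trans (hrow ((fun _ => 0), ⟨0, hd0⟩))
  -- the profile: minimum over the axes of the two-sided profile in the doubled coordinates
  have huniv : (Finset.univ : Finset (Fin d)).Nonempty := ⟨⟨0, hd0⟩, Finset.mem_univ _⟩
  set H : Fin d → ZdEdge d → ℤ := fun i z => 2 * z.1 i + (if z.2 = i then 1 else 0) with hH
  set p : ZdEdge d → ZdEdge d → ℝ := fun x y => Finset.univ.inf' huniv fun i => θ ^ (H i x - H i y).natAbs with hp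
  have hp0 : ∀ x y, 0 ≤ p x y := fun x y => (Finset.le_inf'_iff huniv _).2 fun i _ => pow_nonneg hθ0.le _
  have hpyy : ∀ y, p y y = 1 := fun y => by
    simp only [hp, sub_self, Int.natAbs_zero, pow_zero]
    exact Finset.inf'_const huniv 1
  have hpy : ∀ y, 0 < p y y := fun y => by rw [hpyy]; exact one_pos
  -- off the target: margin-free columns (`column_le_of_split` with `s = 1`)
  have hcol : ∀ (y x : ZdEdge d), x ≠ y → ∑ z ∈ nbr x, C x z * p z y ≤ p x y := by
    intro y x _
    obtain ⟨i₀, -, hi₀⟩ := Finset.exists_mem_eq_inf' huniv (fun i => θ ^ (H i x - H i y).natAbs)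
    have hpx : p x y = θ ^ (H i₀ x - H i₀ y).natAbs := hi₀
    calc ∑ z ∈ nbr x, C x z * p z y ≤ ∑ z ∈ nbr x, C x z * θ ^ (H i₀ z - H i₀ y).natAbs :=
          Finset.sum_le_sum fun z _ => mul_le_mul_of_nonneg_left (Finset.inf'_le _ (Finset.mem_univ i₀)) (hKR.nonneg x z)
      _ ≤ 1 * θ ^ (H i₀ x - H i₀ y).natAbs := column_le_of_split hd hA hL0 hsplit hLrow hnbr hθ0 hθ1 hsup x i₀ (H i₀ y)
      _ = p x y := by rw [one_mul, hpx]
  -- at the target: the row along the link's own axis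
  have hpt : ∀ y : ZdEdge d, ∑ z ∈ nbr y, C y z * p z y ≤ s₀ * p y y := by
    intro y
    rw [hpyy, mul_one]
    calc ∑ z ∈ nbr y, C y z * p z y ≤ ∑ z ∈ nbr y, C y z * θ ^ (H y.2 z - H y.2 y).natAbs :=
          Finset.sum_le_sum fun z _ => mul_le_mul_of_nonneg_left (Finset.inf'_le _ (Finset.mem_univ y.2)) (hKR.nonneg y z)
      _ ≤ A * (2 * ((d : ℝ) - 1) * (2 * θ + 1)) + Λ := column_target_le_of_split hd hA hL0 hsplit hLrow hθ0 hθ1 y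
      _ ≤ s₀ := hs0
  -- the pair profile bound from the `ℓ∞` distance
  have hpd : ∀ x ∈ Δf, ∀ y ∈ Δg, p x y / p y y ≤ θ⁻¹ * (θ ^ 2) ^ n := by
    intro x hx y hy
    rw [hpyy, div_one]
    rcases Nat.eq_zero_or_pos n with hn | hn
    · subst hn
      rw [pow_zero, mul_one]
      refine le_trans ?_ ((one_le_inv₀ hθ0).2 hθ1)
      exact (Finset.inf'_le _ (Finset.mem_univ (⟨0, hd0⟩ : Fin d))).trans (pow_le_one₀ hθ0.le hθ1)
    · obtain ⟨i, hi⟩ := exists_le_natAbs_hc_sub (by omega) (hdist x hx y hy)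
      refine (Finset.inf'_le _ (Finset.mem_univ i)).trans ?_
      refine (pow_le_pow_of_le_one hθ0.le hθ1 hi).trans ?_
      exact pow_two_mul_sub_one_le' hθ0 hθ1 n
  -- Föllmer's pairwise estimate with margin at the target
  have key := abs_covariance_le_pairwise_of_target hγ hKR (r := suFrobDist) (R := 2 * Real.sqrt N) suFrobDist_nonneg
    suFrobDist_le (by positivity) hρ0 hρ hrow hμ hfm hfdep hMf hδf hgm hgdep hMg hδg hs1 hp0 (fun y _ => hpy y)
    (fun y _ x hxy => hcol y x hxy) (fun y _ => hpt y)
  refine key.trans ?_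
  have h1s : 0 < 1 - s₀ := by linarith
  have hsum : ∑ x ∈ Δf, ∑ y ∈ Δg, δf x * (p x y / p y y) * δg y ≤ ∑ x ∈ Δf, ∑ y ∈ Δg, δf x * (θ⁻¹ * (θ ^ 2) ^ n) * δg y :=
    Finset.sum_le_sum fun x hx => Finset.sum_le_sum fun y hy =>
      mul_le_mul_of_nonneg_right (mul_le_mul_of_nonneg_left (hpd x hx y hy) (hδf.nonneg x)) (hδg.nonneg y)
  have hN4 : (2 * Real.sqrt (N : ℝ)) ^ 2 = 4 * N := by rw [mul_pow, Real.sq_sqrt (by positivity)]; norm_num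
  calc (2 * Real.sqrt (N : ℝ)) ^ 2 / (1 - s₀) * ∑ x ∈ Δf, ∑ y ∈ Δg, δf x * (p x y / p y y) * δg y
      ≤ (2 * Real.sqrt (N : ℝ)) ^ 2 / (1 - s₀) * ∑ x ∈ Δf, ∑ y ∈ Δg, δf x * (θ⁻¹ * (θ ^ 2) ^ n) * δg y :=
        mul_le_mul_of_nonneg_left hsum (div_nonneg (sq_nonneg _) h1s.le)
    _ = 4 * N / (θ * (1 - s₀)) * (∑ y ∈ Δg, δg y) * (∑ x ∈ Δf, δf x) * θ ^ (2 * n) := by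
        have e : ∑ x ∈ Δf, ∑ y ∈ Δg, δf x * (θ⁻¹ * (θ ^ 2) ^ n) * δg y = θ⁻¹ * (θ ^ 2) ^ n * ((∑ x ∈ Δf, δf x) * ∑ y ∈ Δg, δg y) := by
          rw [Finset.sum_mul, Finset.mul_sum]
          refine Finset.sum_congr rfl fun x _ => ?_
          rw [Finset.mul_sum, Finset.mul_sum]
          exact Finset.sum_congr rfl fun y _ => by ring
        rw [e, hN4, ← pow_mul]
        field_simp

/-! ### The Wilson centre, sharp form -/

/-- **THE WILSON CENTRE, SHARP FORM**: `d ≥ 2`, `N ≥ 1`, 't Hooft `β`, `OneLinkKRModulus N b K` on `b ≥ 2(d−1)|β|`, `κ = K|β|`; rows `6(d−1)κ < 1`; `0 < θ ≤ 1` with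
`κ·max(2(d−1)(θ+θ⁻¹+1), θ⁻²+2θ⁻¹+2θ+θ²+6(d−2)) ≤ 1` (the two conditions of `ZdAxisClustering.ym_abs_cov_le_axis`) and `κ·2(d−1)(2θ+1) ≤ s₀ < 1`.  Then EVERY DLR state and
ALL bounded measurable local Lipschitz `f, g` with supports at `ℓ∞`-distance `≥ n` satisfy `|cov_μ(f,g)| ≤ (4N/(θ(1−s₀)))(Σδ_g)(Σδ_f) θ^{2n}`. [folklore] -/
theorem ym_abs_cov_le_linfty_sharp (hd : 2 ≤ d) (hN : 1 ≤ N) {β b K : ℝ} (hK : 0 ≤ K) (hb : |β| * (2 * ((d : ℝ) - 1)) ≤ b)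
    (hmod : OneLinkKRModulus N b K) (hρ : 6 * ((d : ℝ) - 1) * |β| * K < 1) {θ s₀ : ℝ} (hθ0 : 0 < θ) (hθ1 : θ ≤ 1)
    (hsup : K * |β| * max (2 * ((d : ℝ) - 1) * (θ + θ⁻¹ + 1)) (θ⁻¹ ^ 2 + 2 * θ⁻¹ + 2 * θ + θ ^ 2 + 6 * ((d : ℝ) - 2)) ≤ 1)
    (hs0 : K * |β| * (2 * ((d : ℝ) - 1) * (2 * θ + 1)) ≤ s₀) (hs1 : s₀ < 1)
    {μ : Measure (LGConfig d (Matrix.specialUnitaryGroup (Fin N) ℂ))}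
    (hμ : μ ∈ ymGibbsMeasures (d := d) (fundamentalRep (Fin N)) (N * β))
    {f g : LGConfig d (Matrix.specialUnitaryGroup (Fin N) ℂ) → ℝ} (hfm : Measurable f) {Δf : Finset (ZdEdge d)}
    (hfdep : DependsOn f (↑Δf : Set (ZdEdge d))) {Mf : ℝ} (hMf : ∀ σ, |f σ| ≤ Mf) {δf : ZdEdge d → ℝ}
    (hδf : IsLipBound suFrobDist f δf) (hgm : Measurable g) {Δg : Finset (ZdEdge d)}
    (hgdep : DependsOn g (↑Δg : Set (ZdEdge d))) {Mg : ℝ} (hMg : ∀ σ, |g σ| ≤ Mg) {δg : ZdEdge d → ℝ}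
    (hδg : IsLipBound suFrobDist g δg) (n : ℕ) (hdist : ∀ x ∈ Δf, ∀ y ∈ Δg, (n : ℝ) ≤ ‖x.1 - y.1‖) :
    |cov[f, g; μ]| ≤ 4 * N / (θ * (1 - s₀)) * (∑ y ∈ Δg, δg y) * (∑ x ∈ Δf, δf x) * θ ^ (2 * n) := by
  classical
  haveI : SecondCountableTopology (Matrix (Fin N) (Fin N) ℂ) :=
    inferInstanceAs (SecondCountableTopology (Fin N → Fin N → ℂ))
  haveI : SecondCountableTopology (Matrix.specialUnitaryGroup (Fin N) ℂ) :=
    Topology.IsEmbedding.subtypeVal.secondCountableTopology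
  have hd1 : 1 ≤ d := by omega
  -- the Wilson `ℤ^d` door (verbatim the tree's `dlrMassGap_of_oneLinkKRModulus` step)
  set C : ZdEdge d → ZdEdge d → ℝ := fun x y => K * |β| * linkInfluence x y with hCdef
  have hC0 : ∀ x y, 0 ≤ C x y := fun x y => by positivity
  have hcontr : ∀ (x : ZdEdge d), ∀ y ∈ linkPlaqNbr x,
      ∀ (ω η : LGConfig d (Matrix.specialUnitaryGroup (Fin N) ℂ)),
      (∀ z, z ≠ y → ω z = η z) →
      ∀ (φ' : Matrix.specialUnitaryGroup (Fin N) ℂ → ℝ) (L : ℝ), Measurable φ' →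
        (∃ M, ∀ s, |φ' s| ≤ M) → 0 ≤ L → (∀ a b, |φ' a - φ' b| ≤ L * suFrobDist a b) →
        |∫ s, φ' s ∂(siteLaw (ymSpecification (fundamentalRep (Fin N)) (N * β)) x ω) -
            ∫ s, φ' s ∂(siteLaw (ymSpecification (fundamentalRep (Fin N)) (N * β)) x η)| ≤
          C x y * L * suFrobDist (ω y) (η y) := by
    intro x y _ ω η hωη φ' L hφm hφb hL hφL
    rw [siteLaw_ymSpecification_thooft β x ω, siteLaw_ymSpecification_thooft β x η]
    have hBω : matrixOpNorm (stapleField β x ω) ≤ b := (matrixOpNorm_stapleField_le hd1 hN β x ω).trans hb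
    have hBη : matrixOpNorm (stapleField β x η) ≤ b := (matrixOpNorm_stapleField_le hd1 hN β x η).trans hb
    have key := hmod _ _ hBω hBη φ' L hφm hφb hL hφL
    refine key.trans ?_
    have hdiff := frobNorm_stapleField_sub_le β x y hωη
    calc K * L * frobNorm (stapleField β x ω - stapleField β x η)
        ≤ K * L * (|β| * linkInfluence x y * suFrobDist (ω y) (η y)) :=
          mul_le_mul_of_nonneg_left hdiff (mul_nonneg hK hL)
      _ = C x y * L * suFrobDist (ω y) (η y) := by simp only [hCdef]; ring
  have hγ : IsSpecification (ymSpecification (d := d) (fundamentalRep (Fin N)) (N * β)) :=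
    isSpecification_ymSpecification_of_t2Space _ (continuous_fundamentalRep (Fin N)) _
  have hKR : IsKRContraction (ymSpecification (d := d) (fundamentalRep (Fin N)) (N * β)) suFrobDist linkPlaqNbr C :=
    isKRContraction_ymSpecification _ (continuous_fundamentalRep (Fin N)) _ hC0 hcontr
  have hμ' : IsGibbsMeasure (ymSpecification (d := d) (fundamentalRep (Fin N)) (N * β)) μ := hμ
  refine abs_cov_le_linfty_of_split_sharp hd hγ hKR (A := K * |β|) (by positivity) (L := fun _ _ => 0) (fun _ _ => le_rfl)
    (fun e y _ => by simp only [hCdef, add_zero]; exact le_rfl) (Λ := 0) (fun e => by simp) (R := 1)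
    (fun e y hy => (norm_sub_le_one_of_mem_linkPlaqNbr hy).trans (by norm_num)) (by linarith) hθ0 hθ1
    (by rw [zero_mul, add_zero]; exact hsup) (by rw [add_zero]; exact hs0) hs1 hμ' hfm hfdep hMf hδf hgm hgdep hMg hδg n hdist

/-! ### Cells, `SU(2)` (quarter modulus), sharp form -/

/-- ★ **`SU(2)`, `d = 4`, Wilson, `β_W = 1/8`, SHARP** (tree coupling `1/16`, 't Hooft `1/32`; quarter modulus on radius `3/16`): `θ = 2/7`, `s₀ = 3/10` — for EVERY DLR state
and ALL bounded measurable local Lipschitz `f, g` with supports at `ℓ∞`-distance `≥ n`: `|cov_μ(f,g)| ≤ 40 (Σδ_g)(Σδ_f)(2/7)^{2n}`, rate `log(49/4) = 2.505` per lattice unit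
(checks: slope `(1/32)·max(28.71, 31.90) = 0.997 ≤ 1`; target `(1/32)·6·(11/7) = 0.295 ≤ 0.3`). [folklore] -/
theorem su2_abs_cov_le_linfty_sharp_oneEighth {μ : Measure (LGConfig 4 (Matrix.specialUnitaryGroup (Fin 2) ℂ))}
    (hμ : μ ∈ ymGibbsMeasures (d := 4) (fundamentalRep (Fin 2)) (2 * (1 / 32)))
    {f g : LGConfig 4 (Matrix.specialUnitaryGroup (Fin 2) ℂ) → ℝ} (hfm : Measurable f) {Δf : Finset (ZdEdge 4)}
    (hfdep : DependsOn f (↑Δf : Set (ZdEdge 4))) {Mf : ℝ} (hMf : ∀ σ, |f σ| ≤ Mf) {δf : ZdEdge 4 → ℝ}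
    (hδf : IsLipBound suFrobDist f δf) (hgm : Measurable g) {Δg : Finset (ZdEdge 4)}
    (hgdep : DependsOn g (↑Δg : Set (ZdEdge 4))) {Mg : ℝ} (hMg : ∀ σ, |g σ| ≤ Mg) {δg : ZdEdge 4 → ℝ}
    (hδg : IsLipBound suFrobDist g δg) (n : ℕ) (hdist : ∀ x ∈ Δf, ∀ y ∈ Δg, (n : ℝ) ≤ ‖x.1 - y.1‖) :
    |cov[f, g; μ]| ≤ 40 * (∑ y ∈ Δg, δg y) * (∑ x ∈ Δf, δf x) * (2 / 7 : ℝ) ^ (2 * n) := by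
  have hmod := SlabAreaLawDimensions.su2_oneLinkKRModulus_of_le_one (R := 3 / 16) (by norm_num)
  have habs : |(1 / 32 : ℝ)| = 1 / 32 := abs_of_pos (by norm_num)
  have h := ym_abs_cov_le_linfty_sharp (d := 4) (N := 2) (by norm_num) (by norm_num) (β := 1 / 32) zero_le_one
    (by rw [habs]; norm_num) hmod (by rw [habs]; norm_num) (θ := 2 / 7) (s₀ := 3 / 10) (by norm_num) (by norm_num)
    (by rw [habs]; norm_num) (by rw [habs]; norm_num) (by norm_num) hμ hfm hfdep hMf hδf hgm hgdep hMg hδg n hdist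
  have e : (4 * ((2 : ℕ) : ℝ) / ((2 / 7 : ℝ) * (1 - 3 / 10))) = 40 := by norm_num
  rw [e] at h
  exact h

/-- ★★ **THE `ℓ∞`-CLUSTERING LAW, `SU(2)`, `d = 4`, SHARP FORM `θ = √β_W` on `0 < β_W ≤ 1/6`** (tree coupling `β_W/2`; quarter modulus): for EVERY DLR state and ALL
bounded measurable local Lipschitz `f, g` with supports at `ℓ∞`-distance `≥ n`: `|cov_μ(f,g)| ≤ (16/√β_W)(Σδ_g)(Σδ_f) β_W^n` — rate `log(1/β_W)` per lattice unit, target margin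
`s₀ = 1/2` (checks at `t = √β_W ≤ 49/120`: slope `1/4 + t/2 + 3t² + t³/2 + t⁴/4 ≤ 0.996`, `(3/2)(t + t² + t³) ≤ 0.97`; target `(3/2)t²(2t+1) ≤ 0.46`; rows `9t²/2 < 1`). [folklore] -/
theorem su2_abs_cov_le_linfty_sharp_law_dim4 {βW : ℝ} (hβ0 : 0 < βW) (hβ : βW ≤ 1 / 6)
    {μ : Measure (LGConfig 4 (Matrix.specialUnitaryGroup (Fin 2) ℂ))}
    (hμ : μ ∈ ymGibbsMeasures (d := 4) (fundamentalRep (Fin 2)) (2 * (βW / 4)))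
    {f g : LGConfig 4 (Matrix.specialUnitaryGroup (Fin 2) ℂ) → ℝ} (hfm : Measurable f) {Δf : Finset (ZdEdge 4)}
    (hfdep : DependsOn f (↑Δf : Set (ZdEdge 4))) {Mf : ℝ} (hMf : ∀ σ, |f σ| ≤ Mf) {δf : ZdEdge 4 → ℝ}
    (hδf : IsLipBound suFrobDist f δf) (hgm : Measurable g) {Δg : Finset (ZdEdge 4)}
    (hgdep : DependsOn g (↑Δg : Set (ZdEdge 4))) {Mg : ℝ} (hMg : ∀ σ, |g σ| ≤ Mg) {δg : ZdEdge 4 → ℝ}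
    (hδg : IsLipBound suFrobDist g δg) (n : ℕ) (hdist : ∀ x ∈ Δf, ∀ y ∈ Δg, (n : ℝ) ≤ ‖x.1 - y.1‖) :
    |cov[f, g; μ]| ≤ 16 / Real.sqrt βW * (∑ y ∈ Δg, δg y) * (∑ x ∈ Δf, δf x) * βW ^ n := by
  have habs : |βW / 4| = βW / 4 := abs_of_pos (by positivity)
  have hrad : |βW / 4| * (2 * (((4 : ℕ) : ℝ) - 1)) ≤ 1 := by rw [habs]; push_cast; nlinarith
  have hmod := SlabAreaLawDimensions.su2_oneLinkKRModulus_of_le_one hrad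
  set t : ℝ := Real.sqrt βW with ht
  have ht0 : 0 < t := Real.sqrt_pos.2 hβ0
  have ht2 : t ^ 2 = βW := Real.sq_sqrt hβ0.le
  have ht1 : t ≤ 49 / 120 := by nlinarith [ht2, ht0]
  have htne : t ≠ 0 := ht0.ne'
  have hθ1 : t ≤ 1 := by linarith
  have ht3 : t ^ 3 ≤ t * (1 / 6) := by nlinarith [ht2]
  have ht4 : t ^ 4 ≤ 1 / 36 := by nlinarith [ht2]
  have hsup : 1 * |βW / 4| *
      max (2 * (((4 : ℕ) : ℝ) - 1) * (t + t⁻¹ + 1)) (t⁻¹ ^ 2 + 2 * t⁻¹ + 2 * t + t ^ 2 + 6 * (((4 : ℕ) : ℝ) - 2)) ≤ 1 := by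
    rw [habs, ← ht2, one_mul]
    have hpar : t ^ 2 / 4 * (2 * (((4 : ℕ) : ℝ) - 1) * (t + t⁻¹ + 1)) ≤ 1 := by
      have e : t ^ 2 / 4 * (2 * (((4 : ℕ) : ℝ) - 1) * (t + t⁻¹ + 1)) = 3 / 2 * (t ^ 3 + t + t ^ 2) := by
        push_cast; field_simp; ring
      rw [e]; nlinarith [pow_pos ht0 3]
    have hperp : t ^ 2 / 4 * (t⁻¹ ^ 2 + 2 * t⁻¹ + 2 * t + t ^ 2 + 6 * (((4 : ℕ) : ℝ) - 2)) ≤ 1 := by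
      have e : t ^ 2 / 4 * (t⁻¹ ^ 2 + 2 * t⁻¹ + 2 * t + t ^ 2 + 6 * (((4 : ℕ) : ℝ) - 2)) =
          1 / 4 + t / 2 + t ^ 3 / 2 + t ^ 4 / 4 + 3 * t ^ 2 := by
        push_cast; field_simp; ring
      rw [e]; nlinarith [pow_pos ht0 3, pow_pos ht0 4]
    rcases le_total (2 * (((4 : ℕ) : ℝ) - 1) * (t + t⁻¹ + 1)) (t⁻¹ ^ 2 + 2 * t⁻¹ + 2 * t + t ^ 2 + 6 * (((4 : ℕ) : ℝ) - 2)) with hle | hle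
    · rw [max_eq_right hle]; exact hperp
    · rw [max_eq_left hle]; exact hpar
  have hs0 : 1 * |βW / 4| * (2 * (((4 : ℕ) : ℝ) - 1) * (2 * t + 1)) ≤ 1 / 2 := by
    rw [habs, ← ht2]; push_cast; nlinarith [pow_pos ht0 3]
  have hρ : 6 * (((4 : ℕ) : ℝ) - 1) * |βW / 4| * 1 < 1 := by rw [habs, ← ht2]; push_cast; nlinarith
  have h := ym_abs_cov_le_linfty_sharp (d := 4) (N := 2) (by norm_num) (by norm_num) (β := βW / 4) (K := 1) zero_le_one le_rfl hmod
    hρ ht0 hθ1 hsup hs0 (by norm_num) (μ := μ) (by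
      have e : ((2 : ℕ) : ℝ) * (βW / 4) = 2 * (βW / 4) := by norm_num
      rw [e]; exact hμ) hfm hfdep hMf hδf hgm hgdep hMg hδg n hdist
  have e1 : (4 * ((2 : ℕ) : ℝ) / (t * (1 - 1 / 2))) = 16 / t := by
    field_simp; ring
  have e2 : t ^ (2 * n) = βW ^ n := by rw [pow_mul, ht2]
  rw [e1, e2] at h
  exact h

/-- ★★ **Every `N ≥ 2`, `d = 4`, hypothesis-free (Bakry–Émery modulus), CLOSED FORM, SHARP**: at 't Hooft coupling `0 < b ≤ 1/64` (bare `Nb`), with `κ = b/(1/2 − 6b)`,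
`θ = 2√κ` and target margin `s₀ = 1/2`, EVERY DLR state of the `SU(N)` Wilson specification on `ℤ⁴` and ALL bounded measurable local Lipschitz `f, g` with supports at
`ℓ∞`-distance `≥ n` satisfy `|cov_μ(f,g)| ≤ (4N/√κ)(Σδ_g)(Σδ_f)(4κ)^n` — rate `log(1/(4κ))` per lattice unit, `N`-uniform in 't Hooft scaling (slope as in
`ZdPairwiseClustering.suN_abs_cov_le_linfty_dim4`; target `6κ(4√κ+1) ≤ 0.44`; rows `18κ < 1`). [cite: arXiv220412737, Lemma 4.1] -/
theorem suN_abs_cov_le_linfty_sharp_dim4 (hN : 2 ≤ N) {b : ℝ} (hb0 : 0 < b) (hb : b ≤ 1 / 64)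
    {μ : Measure (LGConfig 4 (Matrix.specialUnitaryGroup (Fin N) ℂ))}
    (hμ : μ ∈ ymGibbsMeasures (d := 4) (fundamentalRep (Fin N)) (N * b))
    {f g : LGConfig 4 (Matrix.specialUnitaryGroup (Fin N) ℂ) → ℝ} (hfm : Measurable f) {Δf : Finset (ZdEdge 4)}
    (hfdep : DependsOn f (↑Δf : Set (ZdEdge 4))) {Mf : ℝ} (hMf : ∀ σ, |f σ| ≤ Mf) {δf : ZdEdge 4 → ℝ}
    (hδf : IsLipBound suFrobDist f δf) (hgm : Measurable g) {Δg : Finset (ZdEdge 4)}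
    (hgdep : DependsOn g (↑Δg : Set (ZdEdge 4))) {Mg : ℝ} (hMg : ∀ σ, |g σ| ≤ Mg) {δg : ZdEdge 4 → ℝ}
    (hδg : IsLipBound suFrobDist g δg) (n : ℕ) (hdist : ∀ x ∈ Δf, ∀ y ∈ Δg, (n : ℝ) ≤ ‖x.1 - y.1‖) :
    |cov[f, g; μ]| ≤ 4 * N / (2 * Real.sqrt (b / (1 / 2 - 6 * b)) * (1 - 1 / 2)) * (∑ y ∈ Δg, δg y) * (∑ x ∈ Δf, δf x) *
      (2 * Real.sqrt (b / (1 / 2 - 6 * b))) ^ (2 * n) := by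
  have hN1 : 1 ≤ N := by omega
  have habs : |b| = b := abs_of_pos hb0
  have hlt : |b| * (2 * (((4 : ℕ) : ℝ) - 1)) < 1 / 2 := by rw [habs]; push_cast; nlinarith
  have hmod := Balaban1983to89.StrongCouplingKernelWindow.oneLinkKRModulus_SU hN hlt
  have hden : 0 < 1 / 2 - 6 * b := by linarith
  set κ : ℝ := b / (1 / 2 - 6 * b) with hκ
  have hκ0 : 0 < κ := div_pos hb0 hden
  have hκ26 : κ ≤ 1 / 26 := by rw [hκ, div_le_iff₀ hden]; linarith
  set t : ℝ := Real.sqrt κ with ht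
  have ht0 : 0 < t := Real.sqrt_pos.2 hκ0
  have ht2 : t ^ 2 = κ := Real.sq_sqrt hκ0.le
  have ht5 : t ≤ 1 / 5 := by nlinarith [ht2, ht0]
  have hKb : 1 / (1 / 2 - |b| * (2 * (((4 : ℕ) : ℝ) - 1))) * |b| = t ^ 2 := by
    rw [habs, ht2, hκ]; push_cast; field_simp; ring
  have hθ0 : 0 < 2 * t := by linarith
  have hθ1 : 2 * t ≤ 1 := by linarith
  have htne : t ≠ 0 := ht0.ne'
  have hsup : 1 / (1 / 2 - |b| * (2 * (((4 : ℕ) : ℝ) - 1))) * |b| *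
      max (2 * (((4 : ℕ) : ℝ) - 1) * (2 * t + (2 * t)⁻¹ + 1)) ((2 * t)⁻¹ ^ 2 + 2 * (2 * t)⁻¹ + 2 * (2 * t) + (2 * t) ^ 2 + 6 * (((4 : ℕ) : ℝ) - 2))
        ≤ 1 := by
    rw [hKb]
    have hpar : t ^ 2 * (2 * (((4 : ℕ) : ℝ) - 1) * (2 * t + (2 * t)⁻¹ + 1)) ≤ 1 := by
      have e : t ^ 2 * (2 * (((4 : ℕ) : ℝ) - 1) * (2 * t + (2 * t)⁻¹ + 1)) = 3 * t + 6 * t ^ 2 + 12 * t ^ 3 := by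
        push_cast; field_simp; ring
      rw [e]; nlinarith [pow_pos ht0 3, pow_le_pow_left₀ ht0.le ht5 2, pow_le_pow_left₀ ht0.le ht5 3]
    have hperp : t ^ 2 * ((2 * t)⁻¹ ^ 2 + 2 * (2 * t)⁻¹ + 2 * (2 * t) + (2 * t) ^ 2 + 6 * (((4 : ℕ) : ℝ) - 2)) ≤ 1 := by
      have e : t ^ 2 * ((2 * t)⁻¹ ^ 2 + 2 * (2 * t)⁻¹ + 2 * (2 * t) + (2 * t) ^ 2 + 6 * (((4 : ℕ) : ℝ) - 2)) =
          1 / 4 + t + 12 * t ^ 2 + 4 * t ^ 3 + 4 * t ^ 4 := by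
        push_cast; field_simp; ring
      rw [e]
      nlinarith [pow_pos ht0 3, pow_pos ht0 4, pow_le_pow_left₀ ht0.le ht5 2, pow_le_pow_left₀ ht0.le ht5 3,
        pow_le_pow_left₀ ht0.le ht5 4]
    rcases le_total (2 * (((4 : ℕ) : ℝ) - 1) * (2 * t + (2 * t)⁻¹ + 1))
        ((2 * t)⁻¹ ^ 2 + 2 * (2 * t)⁻¹ + 2 * (2 * t) + (2 * t) ^ 2 + 6 * (((4 : ℕ) : ℝ) - 2)) with hle | hle
    · rw [max_eq_right hle]; exact hperp
    · rw [max_eq_left hle]; exact hpar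
  have hs0 : 1 / (1 / 2 - |b| * (2 * (((4 : ℕ) : ℝ) - 1))) * |b| * (2 * (((4 : ℕ) : ℝ) - 1) * (2 * (2 * t) + 1)) ≤ 1 / 2 := by
    rw [hKb]; push_cast; nlinarith [pow_pos ht0 3, pow_le_pow_left₀ ht0.le ht5 2, pow_le_pow_left₀ ht0.le ht5 3]
  have hρ : 6 * (((4 : ℕ) : ℝ) - 1) * |b| * (1 / (1 / 2 - |b| * (2 * (((4 : ℕ) : ℝ) - 1)))) < 1 := by
    have e : 6 * (((4 : ℕ) : ℝ) - 1) * |b| * (1 / (1 / 2 - |b| * (2 * (((4 : ℕ) : ℝ) - 1)))) =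
        18 * (1 / (1 / 2 - |b| * (2 * (((4 : ℕ) : ℝ) - 1))) * |b|) := by push_cast; ring
    rw [e, hKb]; nlinarith [pow_le_pow_left₀ ht0.le ht5 2]
  have h := ym_abs_cov_le_linfty_sharp (d := 4) (N := N) (by norm_num) hN1 (β := b) (K := 1 / (1 / 2 - |b| * (2 * (((4 : ℕ) : ℝ) - 1))))
    (by positivity) le_rfl hmod hρ hθ0 hθ1 hsup hs0 (by norm_num) hμ hfm hfdep hMf hδf hgm hgdep hMg hδg n hdist
  rw [ht] at h
  exact h

end Summit.Ventures.YMGap.RobustBall.ZdAxis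

end
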